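import Mathlib
import Summits.Ventures.HodgeRepro.Tier4.Target
import Summits.Ventures.HodgeRepro.Tier4.Line3.Defs
import Summits.Ventures.HodgeRepro.Tier4.Line3.LocaliserS
import Summits.Ventures.HodgeRepro.Tier4.Line3.KMDatum
import Summits.Ventures.HodgeRepro.Tier4.Line3.Majorant
import Summits.Ventures.HodgeRepro.Tier4.Line3.MajorantNorm
import Summits.Ventures.HodgeRepro.Tier4.Line3.BallCoordLemmas
import Summits.Ventures.HodgeRepro.Tier4.Line3.OrbitInvariant
import Summits.Ventures.HodgeRepro.Tier4.Line3.KernelBound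
import Summits.Ventures.HodgeRepro.Tier4.Line3.ClassBoundGauss
import Summits.Ventures.HodgeRepro.Tier4.Line3.ClassBoundDef
import Summits.Ventures.HodgeRepro.Tier4.Line3.LatticeGaussDefs
import Summits.Ventures.HodgeRepro.Tier4.Line3.LatticeEmbedLemmas

/-!
# Tier4/Line3/LatticeGaussPointwise — the per-vector factor of the majorant and its Gaussian bound (rung for (R2))

Blind re-derivation cell `pub-hodge-repro`, Tier 4 «PROVE THE STEP» (README §9–§10), LINE L3, seat t4-x2 (reserve
wall-breaker) on (R2) THE LATTICE GAUSSIAN SUM of L3.5's residual (lead g385 S12860 (R-IV); L2-p1's census S12833).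

`majorantDefAt c₁ Φ e w z` (t4-L2-p3's ClassBoundDef) is `(aNorm Φ z 0 + aNorm Φ z 1)^4` times the product over the four
slots of the PER-VECTOR FACTOR `vecFactor c₁ e v z = (1 + ‖y‖)^e (Σ_i ‖y_i‖)² e^{−(π/2) maj(y, z)} · gaussDefAt c₁ v`,
`y = ballCoord v`, at the chosen representatives `rep w j` (`majorantDefAt_eq_prod`).  The factor is invariant under the
norm-one scalars (`vecFactor_smul`: `‖τ₀ t‖ = 1`, `maj_smul`, `gaussDefAt_smul`), so it is a function of the line.  Its
GAUSSIAN BOUND (`vecFactor_le`): with `M = ‖embV v‖` the sup norm of all the archimedean coordinates,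
`vecFactor c₁ e v z ≤ K₁ (1 + M)^{k} · exp(−c₃ (1 − |z|²) M²)`, `k = max e 0 + 2`, uniformly in `z ∈ 𝔹` — the `τ₀`-Gaussian
pays for the coordinates at `τ₀, τ̄₀` (`MajorantNorm.nsq_mul_norm_sq_le_maj`: the majorant dominates `(1 − |z|²) ‖y‖²/4`,
and `τ₀(v) = C y`), the definite Gaussians for the others (`gaussDefAt_le_exp`); the polynomial prefactor is bounded
through `y = C⁻¹ τ₀(v)`.  `LatticeGaussSum.lean` sums this bound over a lattice.

Nothing here asserts anything about the truth of (P); HC_CM is NOT proved by anyone in this repository.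
-/

set_option autoImplicit false

noncomputable section

namespace Summit.Ventures.HodgeRepro.Tier4.Line3

open Matrix NumberField

namespace T4Data

variable (X : T4Data)

/-- `0 ≤ vecFactor`. -/
theorem vecFactor_nonneg (c₁ e : ℝ) (v : Fin 3 → X.E) (z : Fin 2 → ℂ) : 0 ≤ X.vecFactor c₁ e v z := by
  unfold vecFactor
  have h1 : 0 ≤ 1 + ‖X.ballCoord v‖ := by positivity
  exact mul_nonneg (mul_nonneg (Real.rpow_nonneg h1 _) (mul_nonneg (sq_nonneg _) (Real.exp_pos _).le))
    (X.gaussDefAt_nonneg _ _)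

/-- The majorant with the definite Gaussians is `(aNorm₀ + aNorm₁)^4` times the product of the per-vector factors at the
chosen representatives. -/
theorem majorantDefAt_eq_prod (c₁ : ℝ) (Φ : KMDatumS) (e : ℝ) (w : X.LineTuple) (z : Fin 2 → ℂ) :
    X.majorantDefAt c₁ Φ e w z = (aNorm Φ z 0 + aNorm Φ z 1) ^ 4 * ∏ j, X.vecFactor c₁ e (X.rep w j) z := by
  unfold majorantDefAt majorantAt vecFactor
  rw [mul_assoc, ← Finset.prod_mul_distrib]

/-- **TORUS INVARIANCE**: the per-vector factor does not change under the norm-one scalars. -/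
theorem vecFactor_smul (c₁ e : ℝ) {t : X.E} (ht : X.c t * t = 1) (v : Fin 3 → X.E) (z : Fin 2 → ℂ) :
    X.vecFactor c₁ e (t • v) z = X.vecFactor c₁ e v z := by
  unfold vecFactor
  have h1 : ‖X.τ₀ t‖ = 1 := X.norm_embedding_eq_one_of_torus X.τ₀ ht
  have hs : (∑ i, ‖(X.τ₀ t • X.ballCoord v) i‖) = ∑ i, ‖X.ballCoord v i‖ :=
    Finset.sum_congr rfl fun i _ => by rw [Pi.smul_apply, norm_smul, h1, one_mul]
  rw [X.ballCoord_smul, norm_smul, h1, one_mul, maj_smul _ h1, X.gaussDefAt_smul c₁ ht, hs]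

/-- The per-vector factor at a representative of the same line. -/
theorem vecFactor_of_lineStep (c₁ e : ℝ) {v v' : Fin 3 → X.E} (h : X.lineStep v v') (z : Fin 2 → ℂ) :
    X.vecFactor c₁ e v' z = X.vecFactor c₁ e v z := by
  obtain ⟨t, ht, rfl⟩ := h
  exact X.vecFactor_smul c₁ e ht v z

/-- `0 ≤ kCinv`. -/
theorem kCinv_nonneg : 0 ≤ X.kCinv := Finset.sum_nonneg fun _ _ => Finset.sum_nonneg fun _ _ => norm_nonneg _

/-- `0 ≤ kC`. -/
theorem kC_nonneg : 0 ≤ X.kC := Finset.sum_nonneg fun _ _ => Finset.sum_nonneg fun _ _ => norm_nonneg _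

/-- `‖(C⁻¹ τ₀ v)_i‖ ≤ kCinv · ‖embV v‖`. -/
theorem norm_ballCoord_apply_le (v : Fin 3 → X.E) (i : Fin 3) : ‖X.ballCoord v i‖ ≤ X.kCinv * ‖X.embV v‖ := by
  unfold ballCoord
  simp only [Matrix.mulVec, dotProduct]
  calc ‖∑ j, X.C⁻¹ i j * X.τ₀ (v j)‖ ≤ ∑ j, ‖X.C⁻¹ i j * X.τ₀ (v j)‖ := norm_sum_le _ _
    _ ≤ ∑ j, ‖X.C⁻¹ i j‖ * ‖X.embV v‖ := by
        refine Finset.sum_le_sum fun j _ => ?_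
        rw [norm_mul]
        exact mul_le_mul_of_nonneg_left (X.norm_apply_le_norm_embV v X.τ₀ j) (norm_nonneg _)
    _ = (∑ j, ‖X.C⁻¹ i j‖) * ‖X.embV v‖ := by rw [Finset.sum_mul]
    _ ≤ X.kCinv * ‖X.embV v‖ := by
        refine mul_le_mul_of_nonneg_right ?_ (norm_nonneg _)
        exact Finset.single_le_sum (f := fun i => ∑ j, ‖X.C⁻¹ i j‖)
          (fun _ _ => Finset.sum_nonneg fun _ _ => norm_nonneg _) (Finset.mem_univ i)

/-- `‖C⁻¹ τ₀ v‖ ≤ kCinv · ‖embV v‖`. -/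
theorem norm_ballCoord_le (v : Fin 3 → X.E) : ‖X.ballCoord v‖ ≤ X.kCinv * ‖X.embV v‖ :=
  (pi_norm_le_iff_of_nonneg (mul_nonneg X.kCinv_nonneg (norm_nonneg _))).mpr fun i =>
    X.norm_ballCoord_apply_le v i

/-- `Σ_i ‖(C⁻¹ τ₀ v)_i‖ ≤ 3 kCinv · ‖embV v‖`. -/
theorem sum_norm_ballCoord_le (v : Fin 3 → X.E) : ∑ i, ‖X.ballCoord v i‖ ≤ 3 * X.kCinv * ‖X.embV v‖ := by
  calc ∑ i, ‖X.ballCoord v i‖ ≤ ∑ _i : Fin 3, X.kCinv * ‖X.embV v‖ :=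
        Finset.sum_le_sum fun i _ => X.norm_ballCoord_apply_le v i
    _ = 3 * X.kCinv * ‖X.embV v‖ := by simp [Finset.sum_const, mul_assoc]

/-- `τ₀ v = C (C⁻¹ τ₀ v)`: the coordinates at `τ₀` are recovered from the ball coordinates. -/
theorem tau_eq_mulVec_ballCoord (v : Fin 3 → X.E) : (fun j => X.τ₀ (v j)) = X.C *ᵥ X.ballCoord v := by
  unfold ballCoord
  rw [Matrix.mulVec_mulVec, Matrix.mul_nonsing_inv X.C ((Matrix.isUnit_iff_isUnit_det X.C).mp X.hC.1),
    Matrix.one_mulVec]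

/-- `‖τ₀ (v j)‖ ≤ kC · Σ_i ‖(C⁻¹ τ₀ v)_i‖`. -/
theorem norm_tau_apply_le (v : Fin 3 → X.E) (j : Fin 3) : ‖X.τ₀ (v j)‖ ≤ X.kC * ∑ i, ‖X.ballCoord v i‖ := by
  have h := congrFun (X.tau_eq_mulVec_ballCoord v) j
  rw [h]
  simp only [Matrix.mulVec, dotProduct]
  calc ‖∑ i, X.C j i * X.ballCoord v i‖ ≤ ∑ i, ‖X.C j i * X.ballCoord v i‖ := norm_sum_le _ _
    _ ≤ ∑ i, ‖X.C j i‖ * ∑ k, ‖X.ballCoord v k‖ := by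
        refine Finset.sum_le_sum fun i _ => ?_
        rw [norm_mul]
        refine mul_le_mul_of_nonneg_left ?_ (norm_nonneg _)
        exact Finset.single_le_sum (f := fun k => ‖X.ballCoord v k‖) (fun _ _ => norm_nonneg _) (Finset.mem_univ i)
    _ = (∑ i, ‖X.C j i‖) * ∑ k, ‖X.ballCoord v k‖ := by rw [Finset.sum_mul]
    _ ≤ X.kC * ∑ k, ‖X.ballCoord v k‖ := by
        refine mul_le_mul_of_nonneg_right ?_ (Finset.sum_nonneg fun _ _ => norm_nonneg _)
        exact Finset.single_le_sum (f := fun j => ∑ i, ‖X.C j i‖)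
          (fun _ _ => Finset.sum_nonneg fun _ _ => norm_nonneg _) (Finset.mem_univ j)

/-- `(a + b + c)² ≤ 3 (a² + b² + c²)`. -/
theorem sq_sum_three_le (a b c : ℝ) : (a + b + c) ^ 2 ≤ 3 * (a ^ 2 + b ^ 2 + c ^ 2) := by
  nlinarith [sq_nonneg (a - b), sq_nonneg (b - c), sq_nonneg (a - c)]

/-- **THE `τ₀`-GAUSSIAN SEES EVERY COORDINATE AT `τ₀`**: `(1 − |z|²) ‖τ₀ (v j)‖² ≤ 12 kC² · maj (C⁻¹ τ₀ v) z`. -/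
theorem nsq_norm_tau_sq_le_maj (v : Fin 3 → X.E) (z : Fin 2 → ℂ) (hz : z ∈ ball) (j : Fin 3) :
    (1 - nsq z) * ‖X.τ₀ (v j)‖ ^ 2 ≤ 12 * X.kC ^ 2 * maj (X.ballCoord v) z := by
  have h1 := X.norm_tau_apply_le v j
  have h2 := nsq_mul_norm_sq_le_maj (X.ballCoord v) z hz
  have h3 := sq_sum_three_le ‖X.ballCoord v 0‖ ‖X.ballCoord v 1‖ ‖X.ballCoord v 2‖
  have hs : ∑ i, ‖X.ballCoord v i‖ = ‖X.ballCoord v 0‖ + ‖X.ballCoord v 1‖ + ‖X.ballCoord v 2‖ := by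
    rw [Fin.sum_univ_three]
  have h0 : 0 ≤ 1 - nsq z := by
    have : nsq z < 1 := hz
    linarith
  have h4 : ‖X.τ₀ (v j)‖ ^ 2 ≤ X.kC ^ 2 * (∑ i, ‖X.ballCoord v i‖) ^ 2 := by
    rw [← mul_pow]
    exact pow_le_pow_left₀ (norm_nonneg _) h1 2
  rw [hs] at h4
  nlinarith [mul_le_mul_of_nonneg_left h4 h0, mul_le_mul_of_nonneg_left h3 (mul_nonneg h0 (sq_nonneg X.kC))]

/-- `kC > 0` (`C` is invertible, so not zero). -/
theorem kC_pos : 0 < X.kC := by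
  have hne : X.C ≠ 0 := by
    intro h0
    have hu := X.hC.1
    rw [h0] at hu
    exact not_isUnit_zero hu
  obtain ⟨i, j, hij⟩ : ∃ i j, X.C i j ≠ 0 := by
    by_contra hall
    apply hne
    ext i j
    exact by_contra fun h => hall ⟨i, j, h⟩
  unfold kC
  refine Finset.sum_pos' (fun _ _ => Finset.sum_nonneg fun _ _ => norm_nonneg _) ⟨i, Finset.mem_univ _, ?_⟩
  refine Finset.sum_pos' (fun _ _ => norm_nonneg _) ⟨j, Finset.mem_univ _, norm_pos_iff.mpr hij⟩

/-- The sup norm of `embV v` is attained at some coordinate. -/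
theorem exists_norm_embV_eq (v : Fin 3 → X.E) : ∃ (σ : X.E →+* ℂ) (i : Fin 3), ‖X.embV v‖ = ‖σ (v i)‖ := by
  have hσ : (Finset.univ : Finset (X.E →+* ℂ)).Nonempty := ⟨X.τ₀, Finset.mem_univ _⟩
  obtain ⟨σ, _, hσeq⟩ := Finset.exists_mem_eq_sup Finset.univ hσ fun σ : X.E →+* ℂ => ‖X.embV v σ‖₊
  obtain ⟨i, _, hieq⟩ := Finset.exists_mem_eq_sup Finset.univ (Finset.univ_nonempty (α := Fin 3))
    fun i : Fin 3 => ‖X.embV v σ i‖₊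
  refine ⟨σ, i, ?_⟩
  rw [Pi.norm_def, hσeq, Pi.nnnorm_def, hieq]
  rfl

/-- `0 < cGauss c₁` for `c₁ > 0`. -/
theorem cGauss_pos {c₁ : ℝ} (hc₁ : 0 < c₁) : 0 < X.cGauss c₁ :=
  lt_min hc₁ (div_pos Real.pi_pos (by have := X.kC_pos; positivity))

/-- **THE GAUSSIAN BOUND ON THE EXPONENTIAL FACTORS**: `e^{−(π/2) maj} · gaussDefAt c₁ v ≤ e^{−c₃ (1 − |z|²) ‖embV v‖²}`. -/
theorem exp_mul_gaussDefAt_le {c₁ : ℝ} (hc₁ : 0 < c₁) (v : Fin 3 → X.E) (z : Fin 2 → ℂ) (hz : z ∈ ball) :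
    Real.exp (-(Real.pi / 2) * maj (X.ballCoord v) z) * X.gaussDefAt c₁ v ≤
      Real.exp (-(X.cGauss c₁ * (1 - nsq z) * ‖X.embV v‖ ^ 2)) := by
  have hz1 : nsq z < 1 := hz
  have hz0 : 0 ≤ nsq z := by unfold nsq; positivity
  have h0 : 0 < 1 - nsq z := by linarith
  have h01 : 1 - nsq z ≤ 1 := by linarith
  have hc₃ := X.cGauss_pos hc₁
  have hc₃a : X.cGauss c₁ ≤ c₁ := min_le_left _ _
  have hc₃b : X.cGauss c₁ ≤ Real.pi / (24 * X.kC ^ 2) := min_le_right _ _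
  have hkC := X.kC_pos
  obtain ⟨σ, i, hσi⟩ := X.exists_norm_embV_eq v
  by_cases hdef : σ ≠ X.τ₀ ∧ σ ≠ conjEmb X.τ₀
  · -- a definite coordinate attains the sup norm: the definite Gaussian pays
    have hg := X.gaussDefAt_le_exp hc₁.le v σ hdef
    have hmaj : 0 ≤ maj (X.ballCoord v) z := maj_nonneg' _ _ hz
    have he1 : Real.exp (-(Real.pi / 2) * maj (X.ballCoord v) z) ≤ 1 := by
      rw [Real.exp_le_one_iff]
      have := Real.pi_pos
      nlinarith
    have hsum : ‖σ (v i)‖ ^ 2 ≤ ∑ k, ‖σ (v k)‖ ^ 2 :=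
      Finset.single_le_sum (f := fun k => ‖σ (v k)‖ ^ 2) (fun _ _ => sq_nonneg _) (Finset.mem_univ i)
    calc Real.exp (-(Real.pi / 2) * maj (X.ballCoord v) z) * X.gaussDefAt c₁ v
        ≤ 1 * Real.exp (-(c₁ * ∑ k, ‖σ (v k)‖ ^ 2)) :=
          mul_le_mul he1 hg (X.gaussDefAt_nonneg _ _) zero_le_one
      _ ≤ Real.exp (-(X.cGauss c₁ * (1 - nsq z) * ‖X.embV v‖ ^ 2)) := by
          rw [one_mul, Real.exp_le_exp, hσi]
          have : X.cGauss c₁ * (1 - nsq z) ≤ c₁ := by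
            calc X.cGauss c₁ * (1 - nsq z) ≤ c₁ * 1 := mul_le_mul hc₃a h01 h0.le hc₁.le
              _ = c₁ := mul_one _
          nlinarith [sq_nonneg ‖σ (v i)‖]
  · -- the sup norm is attained at `τ₀` or `τ̄₀`: the `τ₀`-Gaussian pays
    have hτ : ‖σ (v i)‖ = ‖X.τ₀ (v i)‖ := by
      rcases not_and_or.mp hdef with h | h
      · rw [not_not.mp h]
      · rw [not_not.mp h]
        simp only [conjEmb, RingHom.comp_apply]
        exact Complex.norm_conj _
    have hg1 : X.gaussDefAt c₁ v ≤ 1 := X.gaussDefAt_le_one hc₁.le v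
    have hm := X.nsq_norm_tau_sq_le_maj v z hz i
    calc Real.exp (-(Real.pi / 2) * maj (X.ballCoord v) z) * X.gaussDefAt c₁ v
        ≤ Real.exp (-(Real.pi / 2) * maj (X.ballCoord v) z) * 1 :=
          mul_le_mul_of_nonneg_left hg1 (Real.exp_pos _).le
      _ ≤ Real.exp (-(X.cGauss c₁ * (1 - nsq z) * ‖X.embV v‖ ^ 2)) := by
          rw [mul_one, Real.exp_le_exp, hσi, hτ]
          -- `c₃ (1 − |z|²) ‖τ₀ (v i)‖² ≤ (π/(24 kC²)) · 12 kC² maj = (π/2) maj`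
          have hk2 : 0 < 24 * X.kC ^ 2 := by positivity
          have h5 : X.cGauss c₁ * ((1 - nsq z) * ‖X.τ₀ (v i)‖ ^ 2) ≤
              Real.pi / (24 * X.kC ^ 2) * (12 * X.kC ^ 2 * maj (X.ballCoord v) z) :=
            mul_le_mul hc₃b hm (mul_nonneg h0.le (sq_nonneg _)) (div_pos Real.pi_pos hk2).le
          have h6 : Real.pi / (24 * X.kC ^ 2) * (12 * X.kC ^ 2 * maj (X.ballCoord v) z) =
              Real.pi / 2 * maj (X.ballCoord v) z := by
            field_simp
            ring
          nlinarith [h5, h6]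

/-- **THE POLYNOMIAL PREFACTOR**: `(1 + ‖y‖)^e (Σ_i ‖y_i‖)² ≤ K₁ (1 + ‖embV v‖)^{max e 0 + 2}`. -/
theorem poly_le (e : ℝ) (v : Fin 3 → X.E) :
    (1 + ‖X.ballCoord v‖) ^ e * (∑ i, ‖X.ballCoord v i‖) ^ 2 ≤
      ((max 1 X.kCinv) ^ (max e 0) * (3 * X.kCinv) ^ 2) * (1 + ‖X.embV v‖) ^ (max e 0 + 2) := by
  set M := ‖X.embV v‖ with hM
  have hM0 : 0 ≤ M := norm_nonneg _
  have hk := X.kCinv_nonneg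
  have hy : ‖X.ballCoord v‖ ≤ X.kCinv * M := X.norm_ballCoord_le v
  have hsum : ∑ i, ‖X.ballCoord v i‖ ≤ 3 * X.kCinv * M := X.sum_norm_ballCoord_le v
  have h1 : (1 + ‖X.ballCoord v‖) ^ e ≤ (1 + ‖X.ballCoord v‖) ^ (max e 0) :=
    Real.rpow_le_rpow_of_exponent_le (by linarith [norm_nonneg (X.ballCoord v)]) (le_max_left _ _)
  have h2 : 1 + ‖X.ballCoord v‖ ≤ max 1 X.kCinv * (1 + M) := by
    have ha : 1 ≤ max 1 X.kCinv := le_max_left _ _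
    have hb : X.kCinv ≤ max 1 X.kCinv := le_max_right _ _
    nlinarith [mul_le_mul_of_nonneg_right hb hM0]
  have h3 : (1 + ‖X.ballCoord v‖) ^ (max e 0) ≤ (max 1 X.kCinv) ^ (max e 0) * (1 + M) ^ (max e 0) := by
    rw [← Real.mul_rpow (by positivity) (by positivity)]
    exact Real.rpow_le_rpow (by positivity) h2 (le_max_right _ _)
  have h4 : (∑ i, ‖X.ballCoord v i‖) ^ 2 ≤ (3 * X.kCinv) ^ 2 * (1 + M) ^ 2 := by
    rw [← mul_pow]
    refine pow_le_pow_left₀ (Finset.sum_nonneg fun _ _ => norm_nonneg _) ?_ 2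
    nlinarith
  have h5 : (1 + M) ^ (max e 0) * (1 + M) ^ 2 = (1 + M) ^ (max e 0 + 2) := by
    rw [Real.rpow_add (by positivity), Real.rpow_two]
  calc (1 + ‖X.ballCoord v‖) ^ e * (∑ i, ‖X.ballCoord v i‖) ^ 2
      ≤ (max 1 X.kCinv) ^ (max e 0) * (1 + M) ^ (max e 0) * ((3 * X.kCinv) ^ 2 * (1 + M) ^ 2) :=
        mul_le_mul (h1.trans h3) h4 (sq_nonneg _) (by positivity)
    _ = ((max 1 X.kCinv) ^ (max e 0) * (3 * X.kCinv) ^ 2) * ((1 + M) ^ (max e 0) * (1 + M) ^ 2) := by ring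
    _ = _ := by rw [h5]

/-- `0 ≤ kPoly e`. -/
theorem kPoly_nonneg (e : ℝ) : 0 ≤ X.kPoly e := by
  unfold kPoly
  have := X.kCinv_nonneg
  positivity

/-- **THE POINTWISE GAUSSIAN BOUND** of the per-vector factor, uniformly on the ball:
`vecFactor c₁ e v z ≤ K₁ (1 + ‖embV v‖)^{max e 0 + 2} · exp(−c₃ (1 − |z|²) ‖embV v‖²)`. -/
theorem vecFactor_le {c₁ : ℝ} (hc₁ : 0 < c₁) (e : ℝ) (v : Fin 3 → X.E) (z : Fin 2 → ℂ) (hz : z ∈ ball) :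
    X.vecFactor c₁ e v z ≤
      X.kPoly e * (1 + ‖X.embV v‖) ^ (max e 0 + 2) * Real.exp (-(X.cGauss c₁ * (1 - nsq z) * ‖X.embV v‖ ^ 2)) := by
  have hre : X.vecFactor c₁ e v z =
      ((1 + ‖X.ballCoord v‖) ^ e * (∑ i, ‖X.ballCoord v i‖) ^ 2) *
        (Real.exp (-(Real.pi / 2) * maj (X.ballCoord v) z) * X.gaussDefAt c₁ v) := by
    unfold vecFactor
    ring
  rw [hre]
  refine mul_le_mul (X.poly_le e v) (X.exp_mul_gaussDefAt_le hc₁ v z hz) ?_ ?_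
  · exact mul_nonneg (Real.exp_pos _).le (X.gaussDefAt_nonneg _ _)
  · exact mul_nonneg (X.kPoly_nonneg e) (Real.rpow_nonneg (by positivity) _)

end T4Data

end Summit.Ventures.HodgeRepro.Tier4.Line3

end
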